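import Literature.Geometry.Lorentzian.KerrRadiusPseudoconvexity
import Literature.Geometry.Lorentzian.KerrRicciFlat
import Literature.Geometry.Lorentzian.KerrDataProofs
import Literature.Geometry.Lorentzian.KerrSchildCoord
import Literature.Geometry.Lorentzian.DalembertianNaturality
import Literature.Geometry.Lorentzian.ChartMetricCoord
import Literature.Geometry.Lorentzian.LeviCivitaProofs
import HarnessLib

/-!
# The Hessian of the Kerr radius in Kerr–Schild coordinates, through the ingoing chart

(family `gr`; namespace `Literature.Geometry.Lorentzian.Kerr`; sequel to
`KerrRadiusPseudoconvexity.lean`.)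

The coordinate Hessian `MetricCoord.hessAt (Kerr.bilin M a) (Kerr.radius a) z` of the
Kerr–Schild radius `r` with respect to the Kerr–Schild Cartesian components `g_{M,a} = η + 2Hℓ⊗ℓ`
(O'Neill 1983, Ch. 3, Lemma 3.49: `Hess r (X,Y) = D²r(X,Y) − dr(Γ(X,Y))`), read through the
ingoing Kerr chart `Ψ(t*, r, μ, φ)` of `KerrIngoingCoordChart.lean`:

* `Kerr.Ingoing.hessAt_bilin_radius_chartFun`: `Hess^{KS} r_{Ψu}(J_u v, J_u w) = Hess^{ing} (u ↦ u¹)_u (v, w)`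
  — naturality of the covariant Hessian under the local isometry `Ψ`
  (`PseudoRiemannianMetric.hessian_comap_apply`) between the Kerr metric on `Kerr.region a r₀`
  and its pull-back to the coordinate domain, whose components are `Kerr.Ingoing.bilin`
  (`Kerr.Ingoing.kerrBilin_jac`), plus `OpensChart.hessian_eq_hessAt` on both sides;
* `MetricCoord.hessAt_dx_one`: for a coordinate function the Hessian is `−Γ(v,w)¹`, so the
  right-hand side at `v = w` is `Kerr.Ingoing.hessR M a u v`;
* `Kerr.Ingoing.fderiv_radius_chartFun_jac`: `dr(J_u v) = v¹`; with `kerrBilin_jac` the null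
  tangent vectors correspond under `J_u` (which is onto, `Kerr.Ingoing.jac_injective`);
* consequently (`Kerr.hessAt_radius_neg_of_offAxis`, `Kerr.hessAt_radius_pos_of_offAxis`) the
  pseudo-convexity dichotomy of `KerrRadiusPseudoconvexity.lean` in Kerr–Schild Cartesian
  coordinates at every OFF-AXIS point (`x ≠ 0 ∨ y ≠ 0`): for `r₊ < r < r_ph⁺` every non-zero
  null vector `w` tangent to `{r = const}` has `Hess r(w,w) < 0`, for `r > r_ph⁻` it has
  `Hess r(w,w) > 0`.

The axis (a coordinate singularity of `Ψ` only) is reached by continuity in the sequel; nothing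
here is specific to a time slice (`t* ∈ ℝ` arbitrary).

## References

* B. O'Neill, *Semi-Riemannian geometry* (1983), Ch. 3, Lemma 3.49 and Prop. 3.59.
* B. Carter, Comm. Math. Phys. 10 (1968) 280–310, §4.
-/

noncomputable section

set_option maxSynthPendingDepth 3

open Set Function Module Bundle TopologicalSpace Manifold
open scoped Manifold ContDiff Topology
open Literature.Geometry.Lorentzian.MetricCoord

namespace Literature.Geometry.Lorentzian

/-! ### The Hessian of a coordinate function -/

/-- **The coordinate Hessian of a coordinate function is minus a Christoffel component**:
`Hess (u ↦ u¹)(v, w) = −Γ(v, w)¹` (`D²u¹ = 0`, `du¹ = dx¹`). O'Neill 1983, Ch. 3, Lemma 3.49.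
[cite: ONeill1983, Ch. 3, Lemma 3.49] -/
theorem MetricCoord.hessAt_dx_one (G : E4 → E4 →L[ℝ] E4 →L[ℝ] ℝ) (u v w : E4) :
    hessAt G (fun u : E4 ↦ u 1) u v w = -(chrAt G u v w 1) := by
  have h1 : fderiv ℝ (fun u : E4 ↦ u 1) = fun _ ↦ E4.dx 1 := by
    funext y
    exact (E4.dx 1).hasFDerivAt.fderiv
  rw [hessAt_apply, h1]
  simp [E4.dx]

namespace Kerr

namespace Ingoing

variable {M a r₀ : ℝ} {u : E4}

/-- **`dr(J_u v) = v¹`**: along the chart the radius is the coordinate `r = u¹`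
(`radius_chartFun`), so by the chain rule the Kerr–Schild differential of `r` evaluated on the
push-forward `J_u v` is the `r`-component of `v`. [folklore] -/
theorem fderiv_radius_chartFun_jac (hu : u ∈ coordDomain r₀) (v : E4) :
    fderiv ℝ (radius a) (chartFun a r₀ u) (jac a u v) = v 1 := by
  have hr : 0 < radius a (chartFun a r₀ u) := by
    rw [radius_chartFun]; exact radialParam_pos r₀ _
  have hcomp : HasFDerivAt (radius a ∘ chartFun a r₀)
      ((fderiv ℝ (radius a) (chartFun a r₀ u)).comp (jac a u)) u :=
    ((contDiffAt_radius hr (n := 1)).differentiableAt one_ne_zero).hasFDerivAt.comp u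
      (hasFDerivAt_chartFun hu)
  have hev : (radius a ∘ chartFun a r₀) =ᶠ[𝓝 u] fun u : E4 ↦ u 1 := by
    filter_upwards [(coordDomain r₀).isOpen.mem_nhds hu] with y hy
    show radius a (chartFun a r₀ y) = y 1
    rw [radius_chartFun, radialParam_of_lt hy.1]
  have hlin : HasFDerivAt (radius a ∘ chartFun a r₀) (E4.dx 1) u :=
    (E4.dx 1).hasFDerivAt.congr_of_eventuallyEq hev
  have heq := hcomp.unique hlin
  have := congrArg (fun L : E4 →L[ℝ] ℝ ↦ L v) heq
  simpa [E4.dx] using this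

/-- `J_u` is onto (it is an injective endomorphism of `E4`, `jac_injective`). [folklore] -/
theorem jac_surjective (hu : u ∈ coordDomain r₀) : Surjective (jac a u) :=
  LinearMap.surjective_of_injective (f := (jac a u).toLinearMap) (jac_injective (a := a) hu)

/-- **The Kerr–Schild Hessian of the radius through the ingoing chart.** For `u` in the
coordinate domain and `v, w ∈ E4`:
`Hess^{g_{M,a}} r_{Ψ u}(J_u v, J_u w) = Hess^{Ψ^*g} (u ↦ u¹)_u (v, w)`, the left side computed with
the Kerr–Schild components `Kerr.bilin M a` and the function `Kerr.radius a`, the right side with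
the rational ingoing components `Kerr.Ingoing.bilin M a` and the coordinate function `r = u¹`.
Proof: both sides are the covariant Hessian of the Kerr metric (`OpensChart.hessian_eq_hessAt`),
which is natural under the local isometry `Ψ` (`PseudoRiemannianMetric.hessian_comap_apply`;
O'Neill 1983, Ch. 3, Prop. 3.59), and `r ∘ Ψ = u¹` on the coordinate domain.
[cite: ONeill1983, Ch. 3, Prop. 3.59] -/
theorem hessAt_bilin_radius_chartFun (hu : u ∈ coordDomain r₀) (v w : E4) :
    hessAt (Kerr.bilin M a) (radius a) (chartFun a r₀ u) (jac a u v) (jac a u w) =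
      hessAt (Ingoing.bilin M a) (fun u : E4 ↦ u 1) u v w := by
  haveI : Kerr.Facts :=
    ⟨Kerr.isConnected_region_holds, Kerr.contMDiff_bilin_holds, Kerr.contMDiff_timeVector_holds⟩
  haveI : (smoothMetric M a r₀).toPseudoRiemannianMetric.HasLeviCivita :=
    (smoothMetric M a r₀).toPseudoRiemannianMetric.hasLeviCivita
  have hψ : ContMDiffOn 𝓘(ℝ, E4) 𝓘(ℝ, E4) ∞ (Ingoing.chart a r₀) (Ingoing.coordDomain r₀) :=
    Ingoing.contMDiffOn_chart
  have hψ' : ∀ z ∈ Ingoing.coordDomain r₀,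
      Injective (mfderiv 𝓘(ℝ, E4) 𝓘(ℝ, E4) (Ingoing.chart a r₀) z) :=
    Ingoing.injective_mfderiv_chart
  have hdim : Module.finrank ℝ E4 = Module.finrank ℝ E4 := rfl
  -- the pull-back metric on the coordinate domain and its components
  let g' := (smoothMetric M a r₀).toPseudoRiemannianMetric.comap
    PseudoRiemannianMetric.contMDiff_pullbackBilin_holds
    (Ingoing.chart a r₀ ∘ (Subtype.val : Ingoing.coordDomain r₀ → E4))
    (contMDiff_immersedChart_comp_val hψ) (injective_mfderiv_immersedChart_comp_val hψ hψ') hdim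
  haveI := g'.hasLeviCivita
  have hrepr : ∀ z : Ingoing.coordDomain r₀, g'.val z = Ingoing.bilin M a z := fun z ↦ by
    rw [val_comap_immersedChart (smoothMetric M a r₀).toPseudoRiemannianMetric hψ hψ' hdim z]
    ext v' w'
    rw [pullbackBilin_apply, Ingoing.mfderiv_chart z.2]
    exact Ingoing.kerrBilin_jac z.2 v' w'
  -- the radius as a function on the chart domain
  set f : region a r₀ → ℝ := fun y ↦ radius a y.1 with hf
  have hr : 0 < radius a (chartFun a r₀ u) := by
    rw [radius_chartFun]; exact radialParam_pos r₀ _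
  have hΦ2 : ContDiffAt ℝ 2 (radius a) (chartFun a r₀ u) := contDiffAt_radius hr
  have hf2 : ContMDiffAt 𝓘(ℝ, E4) 𝓘(ℝ, ℝ) 2 f (Ingoing.chart a r₀ u) := by
    show ContMDiffAt 𝓘(ℝ, E4) 𝓘(ℝ, ℝ) 2 (radius a ∘ (Subtype.val : region a r₀ → E4)) _
    exact hΦ2.contMDiffAt.comp (Ingoing.chart a r₀ u)
      ((contMDiff_subtype_val (n := 2)) (Ingoing.chart a r₀ u))
  -- (1) Kerr–Schild side
  have h1 := OpensChart.hessian_eq_hessAt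
    (g := (smoothMetric M a r₀).toPseudoRiemannianMetric) (G := Kerr.bilin M a)
    (fun y ↦ smoothMetric_val M a r₀ y) (Ingoing.chart a r₀ u) (f := f) (Φ := radius a)
    (fun _ ↦ rfl) hΦ2 (jac a u v) (jac a u w)
  -- (2) naturality under `Ψ`
  have h2 := (smoothMetric M a r₀).toPseudoRiemannianMetric.hessian_comap_apply
    PseudoRiemannianMetric.contMDiff_pullbackBilin_holds (contMDiff_immersedChart_comp_val hψ)
    (injective_mfderiv_immersedChart_comp_val hψ hψ') hdim (u := ⟨u, hu⟩) (f := f) hf2 v w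
  rw [mfderiv_immersedChart_comp_val_apply hψ ⟨u, hu⟩ v,
    mfderiv_immersedChart_comp_val_apply hψ ⟨u, hu⟩ w, Ingoing.mfderiv_chart hu] at h2
  -- (3) ingoing side: `f ∘ Ψ = u¹` on the coordinate domain
  have hfΨ : ∀ y : Ingoing.coordDomain r₀,
      (f ∘ (Ingoing.chart a r₀ ∘ (Subtype.val : Ingoing.coordDomain r₀ → E4))) y =
        (fun u : E4 ↦ u 1) y := fun y ↦ by
    show radius a (chartFun a r₀ y) = (y : E4) 1
    rw [radius_chartFun, radialParam_of_lt y.2.1]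
  have hproj : ContDiffAt ℝ 2 (fun u : E4 ↦ u 1) u := (E4.dx 1).contDiff.contDiffAt
  have h3 := OpensChart.hessian_eq_hessAt (g := g') (G := Ingoing.bilin M a) hrepr ⟨u, hu⟩
    (f := f ∘ (Ingoing.chart a r₀ ∘ (Subtype.val : Ingoing.coordDomain r₀ → E4)))
    (Φ := fun u : E4 ↦ u 1) hfΨ hproj v w
  -- combine
  calc hessAt (Kerr.bilin M a) (radius a) (chartFun a r₀ u) (jac a u v) (jac a u w)
      = (smoothMetric M a r₀).toPseudoRiemannianMetric.hessian f (Ingoing.chart a r₀ u)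
          (jac a u v) (jac a u w) := h1.symm
    _ = g'.hessian (f ∘ (Ingoing.chart a r₀ ∘ (Subtype.val : Ingoing.coordDomain r₀ → E4)))
          ⟨u, hu⟩ v w := h2.symm
    _ = hessAt (Ingoing.bilin M a) (fun u : E4 ↦ u 1) u v w := h3

/-- The same at `v = w`, in terms of the radial acceleration `hessR` of
`KerrRadiusPseudoconvexity.lean`: `Hess^{KS} r_{Ψu}(J_u v, J_u v) = hessR(u, v)`. [folklore] -/
theorem hessAt_bilin_radius_chartFun_self (hu : u ∈ coordDomain r₀) (v : E4) :
    hessAt (Kerr.bilin M a) (radius a) (chartFun a r₀ u) (jac a u v) (jac a u v) =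
      hessR M a u v := by
  rw [hessAt_bilin_radius_chartFun hu, MetricCoord.hessAt_dx_one]
  rfl

end Ingoing

/-! ### Pseudo-convexity of the cylinders in Kerr–Schild coordinates, off the axis -/

/-- **Inward bending off the axis (Kerr–Schild coordinates).** In sub-extremal Kerr (`0 < M`,
`|a| < M`), at every point `z` of ingoing Kerr–Schild coordinate space off the symmetry axis
(`x ≠ 0 ∨ y ≠ 0`) with `r₊ < r(z) < r_ph⁺ = photonOrbitRadius M (−|a|)`, every non-zero vector `w`
that is null for `g_{M,a}` and tangent to the cylinder `{r = r(z)}` (`dr_z(w) = 0`) has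
`Hess r (w, w) < 0` — the cylinder is strongly null pseudo-convex towards `{r < c}`. Transfer of
`Kerr.Ingoing.hessR_neg_of_lt_photonOrbitRadius_neg` through the chart `Ψ` (onto off the axis,
`Kerr.Ingoing.exists_chartFun_eq`; `J_u` onto). [cite: IonescuKlainerman2012, Def. 1.1] -/
theorem hessAt_radius_neg_of_offAxis {M a : ℝ} (hM : 0 < M) (ha : |a| < M) {z : E4}
    (hz₁ : rPlus M a < radius a z) (hz₂ : radius a z < photonOrbitRadius M (-|a|))
    (hoff : z 1 ≠ 0 ∨ z 2 ≠ 0) {w : E4} (hw : w ≠ 0) (hnull : Kerr.bilin M a z w w = 0)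
    (htan : fderiv ℝ (radius a) z w = 0) :
    hessAt (Kerr.bilin M a) (radius a) z w w < 0 := by
  have hrp : 0 < rPlus M a := by
    have : M ≤ rPlus M a := by unfold rPlus; linarith [Real.sqrt_nonneg (M ^ 2 - a ^ 2)]
    linarith
  have hz : z ∈ region a 0 := by
    rw [mem_region, max_self]; linarith
  obtain ⟨u, hu, rfl⟩ := Ingoing.exists_chartFun_eq (a := a) (r₀ := 0) hz hoff
  obtain ⟨v, rfl⟩ := Ingoing.jac_surjective (a := a) hu w
  have hu1 : u 1 = radius a (Ingoing.chartFun a 0 u) := by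
    rw [Ingoing.radius_chartFun, Ingoing.radialParam_of_lt hu.1]
  have hv : v ≠ 0 := by
    rintro rfl; exact hw (map_zero _)
  have hnull' : Ingoing.bilin M a u v v = 0 := by
    rw [← Ingoing.kerrBilin_jac hu]; exact hnull
  have htan' : v 1 = 0 := by
    rw [← Ingoing.fderiv_radius_chartFun_jac hu v]; exact htan
  have hμ : u 2 ^ 2 < 1 := by
    have h := hu.2; nlinarith [h.1, h.2]
  rw [Ingoing.hessAt_bilin_radius_chartFun_self hu]
  exact Ingoing.hessR_neg_of_lt_photonOrbitRadius_neg hM ha (by rw [hu1]; exact hz₁)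
    (by rw [hu1]; exact hz₂) hμ hv hnull' htan'

/-- **Outward bending off the axis (Kerr–Schild coordinates).** In sub-extremal Kerr, at every
off-axis point with `r(z) > r_ph⁻ = photonOrbitRadius M |a|`, every non-zero null vector tangent
to `{r = r(z)}` has `Hess r (w, w) > 0` — the cylinder is strongly null pseudo-convex towards
`{r > c}`. Transfer of `Kerr.Ingoing.hessR_pos_of_photonOrbitRadius_lt`.
[cite: IonescuKlainerman2012, Def. 1.1] -/
theorem hessAt_radius_pos_of_offAxis {M a : ℝ} (hM : 0 < M) (ha : |a| < M) {z : E4}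
    (hz : photonOrbitRadius M |a| < radius a z) (hoff : z 1 ≠ 0 ∨ z 2 ≠ 0) {w : E4} (hw : w ≠ 0)
    (hnull : Kerr.bilin M a z w w = 0) (htan : fderiv ℝ (radius a) z w = 0) :
    0 < hessAt (Kerr.bilin M a) (radius a) z w w := by
  have h3 : 3 * M ≤ photonOrbitRadius M |a| := (photonOrbitRadius_mem hM (abs_nonneg a)).1
  have hzr : z ∈ region a 0 := by
    rw [mem_region, max_self]; linarith
  obtain ⟨u, hu, rfl⟩ := Ingoing.exists_chartFun_eq (a := a) (r₀ := 0) hzr hoff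
  obtain ⟨v, rfl⟩ := Ingoing.jac_surjective (a := a) hu w
  have hu1 : u 1 = radius a (Ingoing.chartFun a 0 u) := by
    rw [Ingoing.radius_chartFun, Ingoing.radialParam_of_lt hu.1]
  have hv : v ≠ 0 := by
    rintro rfl; exact hw (map_zero _)
  have hnull' : Ingoing.bilin M a u v v = 0 := by
    rw [← Ingoing.kerrBilin_jac hu]; exact hnull
  have htan' : v 1 = 0 := by
    rw [← Ingoing.fderiv_radius_chartFun_jac hu v]; exact htan
  have hμ : u 2 ^ 2 < 1 := by
    have h := hu.2; nlinarith [h.1, h.2]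
  rw [Ingoing.hessAt_bilin_radius_chartFun_self hu]
  exact Ingoing.hessR_pos_of_photonOrbitRadius_lt hM ha (by rw [hu1]; exact hz) hμ hv hnull' htan'

end Kerr

end Literature.Geometry.Lorentzian

end
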